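import Mathlib
import HarnessLib
import HarnessLib.Audit
import Summits.Schanuel.Statement
import Literature.NumberTheory.Transcendental.ZilberField

/-!
Route: EclCore

CLOSED (closed) 2026-08-15T10:41:17Z by planner-Schanuel-route-Schanuel-EclCore-0 — reason: reduction-proved (route-repair, cone guardrail): X ↔ Schanuel is a Literature theorem, 0 cruxes, remaining content = summit; cone unrepairable at route level — note: route-repair (cone guardrail) census — EXHAUSTED = line carried to completion, nothing stalled or refuted. TRIED/DONE: the route's whole content, Kirby's reduction X ↔ Schanuel (X = Schanuel on ℚ-independent tuples in ecl ∅), is PROVED in Literature: schanuelConjecture_iff_ecl_empty_holds (KirbyWeak. The file is kept as the record of this route; refuted decls are indexed as negative knowledge (`ledger negatives`).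

# Route Schanuel/EclCore — Schanuel lives on the countable field of exponentially-algebraic numbers

## Thesis X
Words: Schanuel's conjecture holds for every ℚ-linearly independent tuple all of whose entries lie
in
E := ecl^ℂ(∅), Kirby's exponential-algebraic closure of ∅ in ℂ_exp (coordinates of non-degenerate
solutions of Khovanskii systems x ↦ f(x, eˣ) = 0 over ℤ; a countable exp-closed subfield containing
ℚ̄, πi, e, log ℚ̄, …).
Lean (elaborates, all constants exist: `Literature.NumberTheory.Transcendental.ecl`,
`Complex.instExponentialRing`, `Algebra.trdeg`):
`∀ (n : ℕ) (x : Fin n → ℂ), (∀ i, x i ∈ Literature.NumberTheory.Transcendental.ecl (∅ : Set ℂ)) →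
LinearIndependent ℚ x → (n : Cardinal) ≤ Algebra.trdeg ℚ ↥(IntermediateField.adjoin ℚ (Set.range x ∪
Set.range (cexp ∘ x)))`

## Assembly X → Schanuel
Kirby2010 (Bull. LMS 42, Thm 1.2–1.3, built on Ax1971 Thm 3): for any exponential field F and any
ecl-closed C ⊆ F, td(x, eˣ / C) ≥ ldim_ℚ(x / C). With C = E: split a ℚ-independent x by a GL_n(ℚ)
change (Schanuel is GL_n(ℚ)-invariant) into x'' ⊂ E (n−k entries) and x' independent mod span_ℚ E
(k entries); td(x,eˣ) ≥ td(x'',e^{x''}) + td(x',e^{x'}/E) ≥ (n−k) [by X] + k [Kirby] = n.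

## Why this line (imports: model-theoretic pregeometries + differential algebra)
Ax1971 settles the functional Schanuel conjecture; Kirby2010 converts it, via derivations on ℂ
respecting exp, into the statement that the Hrushovski predimension δ(x) = td(x,eˣ) − ldim_ℚ x is
non-negative *relative to* E. Hence every essential counterexample to Schanuel is a tuple of
exponentially-algebraic numbers: the conjecture is a countable, explicitly enumerable family of
instances (Khovanskii systems over ℤ), which (a) is the exact overlap with the Zilber route
(BaysKirby2018 §1: under EAC, ℂ_exp is determined up to isomorphism by its countable core E, so X is
precisely what separates ℂ_exp from Zilber's 𝔹), (b) makes certified search for counterexamples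
meaningful, (c) isolates the n = 2 instances (e,π), (e,e^e), (log 2, 2^{√2}) as first targets.
Considered and not used: o-minimal point counting (Pila–Wilkie) — yields transcendence (td ≥ 1) and
functional statements only, no known mechanism for td ≥ 2; "generic tuples" (BaysKirbyWilkie2010)
are outside E by definition and already covered by Kirby's theorem.

## Ranked cruxes
2. Kirby's relative Schanuel theorem for ℂ over E (Literature theorem to formalise; signature filed;
   uses `Submodule.span ℚ (Literature.NumberTheory.Transcendental.ecl ∅)).mkQ` for ldim mod E and
nested `IntermediateField.adjoin`).
3. Schanuel for n = 2 (all famous pairs live in E²): `∀ x : Fin 2 → ℂ, LinearIndependent ℚ x → 2 ≤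
trdeg …`.
4. Flagship instance `Literature.NumberTheory.Transcendental.ExpOnePiAlgebraicIndependent` (x = (1,
πi)).
5. Facts wanted as hypotheses: Ax1971 Thm 3 (power-series Schanuel);
`Literature.NumberTheory.Transcendental.ecl ∅` is an exp-subfield
   and countable (`Literature.NumberTheory.Transcendental.hasCountableClosureProperty_complex`).
6. ¬Schanuel (search side): a counterexample, necessarily in Eⁿ by crux 2.

## Kill criteria
Crux 2 refuted for ℂ (impossible if Kirby2010 is right — would indicate a mis-formalisation of
`Literature.NumberTheory.Transcendental.ecl`);
a proved counterexample in Eⁿ refutes Schanuel and closes every route.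

## Not decomposed yet
Structure of E (tower by Khovanskii depth), depth-1 = ℚ̄ ∪ log ℚ̄ sector (= LW + alg. indep. of
logs,
see route ToricPeriods), any transcendence method for depth ≥ 2.

UNDER FLOOR: fewer than 2 cruxes remain after retriage (legacy route; D-0019).

Novelty: NOVELTY (retriage pass 2026-08-14; searches run BEFORE this claim: `lit search "exponentially
algebraic closure essential counterexample Schanuel conjecture" -n 12` (36 local docs; page hits
paper:arxiv-0810.4285 pp.2-3,11; paper:arxiv-0912.4019 pp.23-24; paper:arxiv-1101.4224 p.5;
paper:arxiv-1512.04262 p.28; paper:arxiv-1701.05841 pp.4,20; paper:arxiv-2010.00102 pp.3-4;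
paper:arxiv-0912.4019 confirmed with `lit read --grep`), `lit vsearch` on the thesis sentence (no
closer hit), `lit frontier Schanuel --since 2020` (30 descendants, none with a numerical handle on
ecl(∅)), `lit bridges Schanuel --cross any`, Grep over
lean/Literature/NumberTheory/Transcendental/{Kirby*,SchanuelEclEmpty*,Ecl*,AxSchanuel*}, kernel
check scratch/Check.lean rc 0).
Nearest prior art — the thesis IS the printed reduction, verbatim:
- Kirby2010EAEF (arXiv:0810.4285): Thm 1.2 p.1 (delta(x/C) >= dim(x/C) for ecl-closed C, from Ax1971
Thm 3 via E-derivations, Thm 5.1/Cor 5.2); Thm 1.4 p.3 "There are at most countably many essential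
counterexamples to Schanuel's conjecture", printed right after "In the complex case this is
Schanuel's conjecture, which is considered out of reach"; Prop 7.2 p.11 "if a is an essential
counterexample to the Schanuel property then a is contained in ecl^F(emptyset)".
- Kirby2013FPEF (arXiv:0912.4019) p.23: "Let C_0 = ecl(emptyset) be the field of
exponentially-algebraic complex numbers ... Thus Schanuel's conjecture (for C) is equivalent to its
restriction to C_0 ... equival  [refs: 0810.4285, 0912.4019, 1101.4224, 1512.04262, 1701.05841, 2010.00102, paper:arxiv-0810.4285, paper:arxiv-0912.4019, paper:arxiv-1101.4224, paper:arxiv-1512.04262, paper:arxiv-1701.05841, paper:arxiv-2010.00102, Ax1971]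

Barriers (technique_class: ax-schanuel exponential-derivations predimension ecl-core): BARRIERS (catalogue lean/Literature/Barriers/Schanuel/, all nine catalogue declarations read
2026-08-14 against technique_class "ax-schanuel exponential-derivations predimension ecl-core"):
- Literature.Barriers.Schanuel.AxSchanuelFunctionalNotNumerical (functional-transcendence /
ax-schanuel / exponential-derivations / predimension; PROVED,
axSchanuelFunctionalNotNumerical_holds): APPLIES SQUARELY and is NOT evaded — this route is the
barrier's own residue (the barrier docstring names Summits/Schanuel/Schanuel/Theses/EclCore.lean).
Kirby Thm 1.2 holds in EVERY exponential field of characteristic 0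
(Kirby2010_weakSchanuel_holds_type0), including fields without the Schanuel property
(not_functionalDerivationOfSchanuel: trivial exp on Q; not_functionalSoftDerivationOfSchanuel:
Bays-Kirby B_P); every E-derivation vanishes on ecl(emptyset)
(eDerivation_apply_eq_zero_of_mem_ecl_empty, Kirby2010EAEF Prop 4.7), so the hypothesis of Ax1971
Thm 3 fails for every tuple meeting ecl(emptyset) (not_isQLinearIndependentMod_of_mem_ecl_empty) —
exactly the tuples X quantifies over, including (1, pi i), (1, e), (log 2, sqrt2 log 2), (pi i, log
2) (classicalPairs_mem_ecl_empty). The imported engine (Ax's theorem + E-derivations + Hrushovski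
predimension) is spent entirely in the now-proved reduction X <-> Schanuel and is provably silent on
X. What survives is bookkeeping: X ranges over a countable, explicitly enumerable set
(ecl_empty_countable), which serves the search side (NotSchanuel) and

History (route lifecycle, newest last):
- 2026-08-15T10:41:17Z · CLOSED closed — reduction-proved (route-repair, cone guardrail): X ↔ Schanuel is a Literature theorem, 0 cruxes, remaining content = summit; cone unrepairable at route level (planner-Schanuel-route-Schanuel-EclCore-0)

sub-problem: Schanuel · status: closed(closed) · opened planner-Schanuel-Survey-0 2026-08-13T06:03:33Z · rev 1 · ledger route-Schanuel-EclCore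
GENERATED by the gate from the ledger (D-0016/17). Provers cite these decls: `theorem foo : Summit.Schanuel.Schanuel.Theses.EclCore.<Decl> := …` in Summits/Schanuel/Schanuel/Theorems/<Name>.lean.
-/

namespace Summit.Schanuel.Schanuel.Theses.EclCore

open scoped BigOperators Topology Manifold Classical MeasureTheory ProbabilityTheory Matrix InnerProductSpace ComplexConjugate ContinuousMap
open Filter Set Function TopologicalSpace MeasureTheory

attribute [summit_statement] _root_.Schanuel

open Literature.Periods

/-- item stmt-Schanuel-0066 · target · rank 0 · open · by planner
why it might fail: X ⟺ Schanuel (kernel-checked: schanuelConjecture_iff_ecl_empty_holds); 'considered out of reach' (Kirby2010 p.3). Fails iff some ℚ-independent Khovanskii tuple has td(x,eˣ)<n; n=2 already holds (e,π),(e,e^e),(log2,2^√2); E-derivations vanish on ecl ∅, so the route's own engine is silent on X.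
sources: Kirby2010EAEF = arXiv:0810.4285 (lit paper:arxiv-0810.4285): Thm 1.2 p.1; Thm 1.4 and 'In the complex case this is Schanuel's conjecture, which is considered out of reach' p.3; Prop 7.2 p.11 (essential counterexamples ⊆ ecl^F(∅)), Kirby2013FPEF = arXiv:0912.4019 p.23: 'C₀ = ecl(∅) … Schanuel's conjecture (for ℂ) is equivalent to its restriction to C₀ … equivalent to the assertion that C₀ embeds in B₀'; p.24 'unique reason' (hull, δ = 0) form, Literature.NumberTheory.Transcendental.schanuelConjecture_iff_ecl_empty_holds (Literature/NumberTheory/Transcendental/KirbyWeakSchanuelAx.lean:578, from ax_schanuel_holds via Rosenlicht1976_prop4_holds): gives EclCore.EclcoreThesis ↔ Schanuel, scratch/Check.lean rc0, axioms propext/Classical.choice/Quot.sound, Literature.Barriers.Schanuel.axSchanuelFunctionalNotNumerical_holds, classicalPairs_mem_ecl_empty, not_isQLinearIndependentMod_of_mem_ecl_empty, ecl_empty_countable (Literature/Barriers/Schanuel/AxSchanuelFunctionalNotNumerical.lean), Waldschmidt2000 Conj 1.14 (source of Literature.Periods.SchanuelConjecture); BakerTNT1975 p.120 (SC ⟹ algebraic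 independence of e and π, open); BaysKirby2018ANT §1.1 ('even the very simple consequence that e and π are algebraically independent is unknown'), BaysKirby2018ANT §9.2 = arXiv:1512.04262 p.28: fields 𝔹_P with all of Zilber's other axioms and a Schanuel counterexample (tree fact Literature.Barriers.Schanuel.baysKirby2018_modelsWithoutSchanuel, AxiomsDoNotForceSchanuel.lean)
Schanuel's conjecture restricted to ℚ-linearly independent tuples with all entries in E = ecl^ℂ(∅)
(Kirby's exponential-algebraic closure of ∅: coordinates of non-degenerate solutions of Khovanskii
systems over ℤ). Equivalent to Schanuel by Kirby2010 Thm 1.2–1.3 (from Ax1971). Sources: Kirby2010,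
Ax1971, Zilber2005 §5. -/
@[route_item "route-Schanuel-EclCore"]
def EclcoreThesis : Prop :=
  ∀ (n : ℕ) (x : Fin n → ℂ), (∀ i, x i ∈ Literature.NumberTheory.Transcendental.ecl (∅ : Set ℂ)) → LinearIndependent ℚ x → (n : Cardinal) ≤ Algebra.trdeg ℚ ↥(IntermediateField.adjoin ℚ (Set.range x ∪ Set.range (Complex.exp ∘ x)))

/-- item stmt-Schanuel-0068 · support · rank 2 · closed · moot by None · by planner
sources: Kirby2010EAEF = arXiv:0810.4285 Thm 1.2 p.1 (verbatim quote in grounder reground note 2026-08-14); Lemma 3.3 p.4; Thm 5.1/Cor 5.2 pp.7-8 (= Ax1971 Thm 3), fact Literature.NumberTheory.Transcendental.kirby_relative_schanuel_complex (KirbyRelativeSchanuel.lean:45) = item signature verbatim; Literature.NumberTheory.Transcendental.kirby_relative_schanuel_complex_holds (KirbyWeakSchanuelAx.lean:588) proves it: scratch/Check.lean t0068 : EclCore.KirbyRelativeSchanuelComplex rc0, axioms propext/Classical.choice/Quot.sound, Literature.NumberTheory.Transcendental.ax_schanuel_holds (RosenlichtProp4Residues.lean:313) ← Rosenlicht.Rosenlicht1976_prop4_holds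 (:283); Ax1971 Thm 3
Kirby2010 (Bull. LMS 42) Thm 1.2/1.3 specialised to F = ℂ_exp, C = ecl(∅): if x₁..xₙ are ℚ-linearly
independent modulo the ℚ-span of E then trdeg over ℚ(E) of ℚ(E)(x, e^x) is ≥ n. A published THEOREM
(proof: derivations on ℂ respecting exp + Ax1971 Thm 3); grounder may convert to a Literature named
fact, after which #1 takes it as (h : Fact). Sources: Kirby2010, Ax1971. -/
@[route_item "route-Schanuel-EclCore"]
def KirbyRelativeSchanuelComplex : Prop :=
  ∀ (n : ℕ) (x : Fin n → ℂ), LinearIndependent ℚ ((Submodule.span ℚ (Literature.NumberTheory.Transcendental.ecl (∅ : Set ℂ))).mkQ ∘ x) → (n : Cardinal) ≤ Algebra.trdeg ↥(IntermediateField.adjoin ℚ (Literature.NumberTheory.Transcendental.ecl (∅ : Set ℂ))) ↥(IntermediateField.adjoin ↥(IntermediateField.adjoin ℚ (Literature.NumberTheory.Transcendental.ecl (∅ : Set ℂ))) (Set.range x ∪ Set.range (Complex.exp ∘ x)))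

/-- item stmt-Schanuel-0440 · support · rank 2 · closed · moot by None · by planner
sources: Kirby2010EAEF = arXiv:0810.4285 Prop 7.2 p.11 and §1 p.3 (Thm 1.4); Kirby2013FPEF = arXiv:0912.4019 p.23 ('Schanuel's conjecture (for ℂ) is equivalent to its restriction to C₀'), Literature.NumberTheory.Transcendental.schanuelConjecture_iff_ecl_empty_of_kirby (SchanuelEclEmptyProofs.lean:242; GL_n(ℚ)-adapted basis + tower law) with Literature.NumberTheory.Transcendental.Kirby2010_ecl_isExpSubfield_holds ℂ (Lemma 3.3) inhabits EclCore.EclcoreKirbyCorFromThm: scratch/Check.lean t0440b rc0, axioms propext/Classical.choice/Quot.sound, Literature.NumberTheory.Transcendental.schanuelConjecture_iff_ecl_empty_holds (KirbyWeakSchanuelAx.lean:578): the corollary fact wi-03870 this item was filed to discharge is itself discharged in Literature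
Reaction to stmt-Schanuel-0068 verdict=KNOWN (Kirby2010 Thm 1.2 over C = ecl ∅, vendored fact
review-queued). Restated WITH the fact as hypothesis: from Kirby relative Schanuel over E = ℚ(ecl ∅)
(hypothesis = body of 0068 verbatim; replace by the named fact once it lands) derive Kirby2010 §1
Corollary: SchanuelConjecture ↔ Schanuel restricted to ℚ-independent tuples in ecl(∅). Proof in
print (Kirby2010 §1 after Thm 1.4; grounder-B estimate ~300 Lean lines): → is restriction; ← : given
ℚ-independent x ∈ ℂⁿ, GL_n(ℚ)-change of basis (Schanuel bound is GL_n(ℚ)-invariant: adjoin of (x,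
e^x) and (Ax, e^{Ax}) have equal trdeg since e^{Ax} is algebraic over e^{x/N}) to split x = (x′, x″)
with x″ ∈ ecl(∅)^k ℚ-independent and x′ ℚ-independent modulo span ecl(∅); then td(x,e^x) ≥
td_E(x′,e^{x′}) + td_ℚ(x″,e^{x″}) ≥ (n−k) + k using the hypothesis for x′ and X for x″ plus
transitivity of trdeg over the tower ℚ ⊆ ℚ(x″,e^{x″}) ⊆ E. This item DISCHARGES the requested
corollary fact wi-03870 (schanuelConjecture_iff_ecl_empty) from the theorem-fact and makes assembly
0408 unconditional on it. Sources: Kirby2010 (Thm 1.1, 1.2, §1 Cor), Ax1971 Thm 3. Sketch: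
routes/EclCore/Sketch3.lean rc0. -/
@[route_item "route-Schanuel-EclCore"]
def EclcoreKirbyCorFromThm : Prop :=
  (∀ (n : ℕ) (x : Fin n → ℂ), LinearIndependent ℚ ((Submodule.span ℚ (Literature.NumberTheory.Transcendental.ecl (∅ : Set ℂ))).mkQ ∘ x) → (n : Cardinal) ≤ Algebra.trdeg ↥(IntermediateField.adjoin ℚ (Literature.NumberTheory.Transcendental.ecl (∅ : Set ℂ))) ↥(IntermediateField.adjoin ↥(IntermediateField.adjoin ℚ (Literature.NumberTheory.Transcendental.ecl (∅ : Set ℂ))) (Set.range x ∪ Set.range (Complex.exp ∘ x)))) → (Literature.Periods.SchanuelConjecture ↔ (∀ (n : ℕ) (x : Fin n → ℂ), (∀ i, x i ∈ Literature.NumberTheory.Transcendental.ecl (∅ : Set ℂ)) → LinearIndependent ℚ x → (n : Cardinal) ≤ Algebra.trdeg ℚ ↥(IntermediateField.adjoin ℚ (Set.range x ∪ Set.range (Complex.exp ∘ x)))))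

/-- item stmt-Schanuel-0069 · support · rank 3 · open · by planner
The n = 2 case of Schanuel's conjecture. Open; contains alg. independence of (e, π) [x=(1,πi)], (e,
e^e) [x=(1,e)], (log 2, 2^√2) [x=(log 2, √2 log 2)], (π, log 2) [x=(πi, log 2)]. All these x lie in
ecl(∅)². Sources: Waldschmidt2000 §1.4, Lang1966. -/
@[route_item "route-Schanuel-EclCore"]
def SchanuelTwo : Prop :=
  ∀ (x : Fin 2 → ℂ), LinearIndependent ℚ x → (2 : Cardinal) ≤ Algebra.trdeg ℚ ↥(IntermediateField.adjoin ℚ (Set.range x ∪ Set.range (Complex.exp ∘ x)))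

/-- item stmt-Schanuel-0070 · support · rank 4 · closed · moot by None · by planner
AlgebraicIndependent ℚ ![Real.exp 1, Real.pi]. Open (even irrationality of e+π is open). Follows
from Schanuel n=2 with x = (1, πi). Sources: Waldschmidt2000 §1.4. -/
@[route_item "route-Schanuel-EclCore"]
def ExpOnePiAlgIndep : Prop :=
  Literature.NumberTheory.Transcendental.ExpOnePiAlgebraicIndependent

/-- item stmt-Schanuel-0071 · support · rank 6 · closed · moot by None · by planner
Negative side. By Kirby's reduction (#2) an essential counterexample is a ℚ-independent tuple of
exponentially-algebraic numbers with td(x,e^x) < n; certified integer-relation search (PSLQ + a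
posteriori algebraic verification) over low-depth Khovanskii points is the only computational angle.
Expected outcome: none found (evidence, not proof). Sources: Kirby2010. -/
@[route_item "route-Schanuel-EclCore"]
def NotSchanuel : Prop :=
  ¬ Schanuel

/-- item stmt-Schanuel-0067 · assembly · rank 1 · closed · moot by None · by planner
From Kirby's relative Schanuel theorem (item #2, may be taken as hypothesis (h : …) once it is a
Literature fact): split x by a GL_n(ℚ) change into x''⊂E and x' independent modulo span_ℚ E;
td(x,e^x) ≥ td(x'',e^x'') + td(x',e^x'/E) ≥ (n-k)+k. Needs: Schanuel is GL_n(ℚ)-invariant; E is an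
exp-closed subfield (Kirby2010 Lemma 3.3/Thm 1.1). Sources: Kirby2010 §1. -/
@[route_item "route-Schanuel-EclCore"]
def Assembly : Prop :=
  (∀ (n : ℕ) (x : Fin n → ℂ), (∀ i, x i ∈ Literature.NumberTheory.Transcendental.ecl (∅ : Set ℂ)) → LinearIndependent ℚ x → (n : Cardinal) ≤ Algebra.trdeg ℚ ↥(IntermediateField.adjoin ℚ (Set.range x ∪ Set.range (Complex.exp ∘ x)))) → Schanuel

/-- item stmt-Schanuel-0408 · assembly · rank 1 · closed · moot by None · by planner
Supersedes stmt-Schanuel-0067 (refuter-refute-B-0: illtyped as planning — assembly omitted the fact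
it uses). Assembly now takes Kirby2010 §1 Corollary (SchanuelConjecture ↔ Schanuel restricted to
tuples in ecl ∅; requested as named fact wi-03870, target name
Literature.NumberTheory.Transcendental.schanuelConjecture_iff_ecl_empty) as an explicit hypothesis,
written inline because the constant is not yet in tree; once it lands this is `(h :
schanuelConjecture_iff_ecl_empty) → X → Schanuel` by unfolding. Residual content: Schanuel unfolds
to Literature.Periods.SchanuelConjecture (Iff.mpr). All mathematical weight sits in the fact
(Kirby2010 Thm 1.1–1.3 + Cor, from Ax1971 Thm 3) and thesis stmt-Schanuel-0066. Sources: Kirby2010,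
Ax1971. -/
@[route_item "route-Schanuel-EclCore"]
def Assembly2 : Prop :=
  (Literature.Periods.SchanuelConjecture ↔ (∀ (n : ℕ) (x : Fin n → ℂ), (∀ i, x i ∈ Literature.NumberTheory.Transcendental.ecl (∅ : Set ℂ)) → LinearIndependent ℚ x → (n : Cardinal) ≤ Algebra.trdeg ℚ ↥(IntermediateField.adjoin ℚ (Set.range x ∪ Set.range (Complex.exp ∘ x))))) → (∀ (n : ℕ) (x : Fin n → ℂ), (∀ i, x i ∈ Literature.NumberTheory.Transcendental.ecl (∅ : Set ℂ)) → LinearIndependent ℚ x → (n : Cardinal) ≤ Algebra.trdeg ℚ ↥(IntermediateField.adjoin ℚ (Set.range x ∪ Set.range (Complex.exp ∘ x)))) → Schanuel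

end Summit.Schanuel.Schanuel.Theses.EclCore
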